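import Summits.QuantumAdvantage.QuantumAdvantage.Theorems.CharDialJLinGroupFreezeA

/-! # CharDialJLinGroupFreeze — part 2/2 (mechanical split for landing of `CharDialJLinGroupFreeze`; content verbatim; scopes re-opened with their variables) -/

noncomputable section

namespace Summit.QuantumAdvantage.AdviceFreeQNC0.JLinPeel
open Finset Summit.QuantumAdvantage.AdviceFreeQNC0 TwistedTransfer

namespace JLinData
variable {p n : ℕ}

section Fin
variable [Fact p.Prime]

/-- **CODE COST** of the group at contraction rate `ρ`: `Σ_{t ≠ 0 supported on G} ρ^{privWt(t)}` — the weight enumerator of the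
group's PRIVATE CODE `{β_t|_{gPrivSet G}}` at `ρ`, minus its constant term (counted with multiplicity if the private code has a
kernel, in which case the cost is `≥ 1` and the group is useless). -/
def codeCost (D : JLinData p n) (G : Finset (Fin (n + 1))) (ρ : ℝ) : ℝ :=
  ∑ t ∈ (tSet p G).erase 0, ρ ^ D.privWt G t
/-- CharDial sub-characteristic helper `codeCost_nonneg` (lens-6 g8 LAND package; see the module docstring). -/
theorem codeCost_nonneg (D : JLinData p n) (G : Finset (Fin (n + 1))) {ρ : ℝ} (hρ : 0 ≤ ρ) : 0 ≤ D.codeCost G ρ :=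
  Finset.sum_nonneg fun _ _ => pow_nonneg hρ _
/-- **The LIGHT GROUPS** at lightness `L` (the combinatorial dial), as DATA: the non-empty sets `G` of ACTIVE cuts whose private
code has minimum private weight `≥ L·|G|` (in particular no kernel).  A **GROUP-CORE** at `L` is data with `lightGroups L = ∅`
(nothing — no single cut, no set of cuts — can be frozen cheaply); a **LIGHT COVER** is `∀ g ∈ activeSet, ∃ G ∈ lightGroups L, g ∈ G`. -/
def lightGroups (D : JLinData p n) (L : ℕ) : Finset (Finset (Fin (n + 1))) :=
  univ.filter fun G => G.Nonempty ∧ G ⊆ D.activeSet ∧ ∀ t ∈ tSet p G, t ≠ 0 → L * G.card ≤ D.privWt G t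
/-- CharDial sub-characteristic helper `mem_lightGroups` (lens-6 g8 LAND package; see the module docstring). -/
theorem mem_lightGroups (D : JLinData p n) {G : Finset (Fin (n + 1))} {L : ℕ} :
    G ∈ D.lightGroups L ↔ (G.Nonempty ∧ G ⊆ D.activeSet ∧ ∀ t ∈ tSet p G, t ≠ 0 → L * G.card ≤ D.privWt G t) := by
  unfold lightGroups
  rw [mem_filter]
  simp only [mem_univ, true_and]
/-- CharDial sub-characteristic helper `not_mem_of_lightGroups_eq_empty` (lens-6 g8 LAND package; see the module docstring). -/
theorem not_mem_of_lightGroups_eq_empty (D : JLinData p n) {L : ℕ} (h : D.lightGroups L = ∅) (G : Finset (Fin (n + 1))) :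
    G ∉ D.lightGroups L := by
  rw [h]; exact notMem_empty G
/-- CharDial sub-characteristic helper `lightGroups_eq_empty_of_forall` (lens-6 g8 LAND package; see the module docstring). -/
theorem lightGroups_eq_empty_of_forall (D : JLinData p n) {L : ℕ} (h : ∀ G, G ∉ D.lightGroups L) : D.lightGroups L = ∅ := by
  ext G
  simp only [notMem_empty, iff_false]
  exact h G
/-- **SPARSE bits** at threshold `R`, as DATA: the non-junta bits that are read (through forms) by at least one and fewer than `R`
cuts.  **DENSE-READ** data at `R` are the data with `sparseBits R = ∅`. -/
def sparseBits (D : JLinData p n) (R : ℕ) : Finset (Fin n) :=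
  univ.filter fun i => (∀ g, i ∉ D.J g) ∧ (∃ g, D.a g i ≠ 0) ∧ (univ.filter fun g : Fin (n + 1) => D.a g i ≠ 0).card < R
/-- CharDial sub-characteristic helper `mem_sparseBits` (lens-6 g8 LAND package; see the module docstring). -/
theorem mem_sparseBits (D : JLinData p n) {R : ℕ} {i : Fin n} :
    i ∈ D.sparseBits R ↔ ((∀ g, i ∉ D.J g) ∧ (∃ g, D.a g i ≠ 0) ∧ (univ.filter fun g : Fin (n + 1) => D.a g i ≠ 0).card < R) := by
  unfold sparseBits
  rw [mem_filter]
  simp only [mem_univ, true_and]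
/-- The code cost of a LIGHT group: `≤ p^{|G|}·ρ^{L·|G|}`. -/
theorem codeCost_le_of_light (D : JLinData p n) {G : Finset (Fin (n + 1))} {L : ℕ} (hG : G ∈ D.lightGroups L) {ρ : ℝ}
    (hρ0 : 0 ≤ ρ) (hρ1 : ρ ≤ 1) : D.codeCost G ρ ≤ (p : ℝ) ^ G.card * ρ ^ (L * G.card) := by
  rw [mem_lightGroups] at hG
  unfold codeCost
  calc (∑ t ∈ (tSet p G).erase 0, ρ ^ D.privWt G t)
      ≤ ∑ t ∈ (tSet p G).erase 0, ρ ^ (L * G.card) :=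
        Finset.sum_le_sum fun t ht => pow_le_pow_of_le_one hρ0 hρ1
          (hG.2.2 t (Finset.mem_of_mem_erase ht) (Finset.ne_of_mem_erase ht))
    _ ≤ ∑ t ∈ tSet p G, ρ ^ (L * G.card) :=
        Finset.sum_le_sum_of_subset_of_nonneg (Finset.erase_subset _ _) (fun _ _ _ => pow_nonneg hρ0 _)
    _ = (p : ℝ) ^ G.card * ρ ^ (L * G.card) := by
        rw [Finset.sum_const, card_tSet, nsmul_eq_mul]; push_cast; ring
/-- **THE RATE WALL** (why no freeze/character move enters the dense generic core): every term of the cost is `≥ ρ^{|gPrivSet G|}`,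
so `codeCost ≥ (p^{|G|} − 1)·ρ^{|gPrivSet G|}` — at least `1` (useless) as soon as `|G|·ln p ≥ |gPrivSet G|·ln(1/ρ) + ln 2`, i.e. for
every group of RATE `|G| / |P_G|` above `κ_p = ln(1/ρ_p)/ln p` (`≈ π²/(18 p² ln p)`, `0.0137` for `p = 5`; the constant of 27290). -/
theorem codeCost_ge (D : JLinData p n) (G : Finset (Fin (n + 1))) {ρ : ℝ} (hρ0 : 0 ≤ ρ) (hρ1 : ρ ≤ 1) :
    ((p : ℝ) ^ G.card - 1) * ρ ^ (D.gPrivSet G).card ≤ D.codeCost G ρ := by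
  unfold codeCost
  have hcard : (((tSet p G).erase 0).card : ℝ) = (p : ℝ) ^ G.card - 1 := by
    rw [Finset.card_erase_of_mem (zero_mem_tSet G), card_tSet]
    have h1 : 1 ≤ p ^ G.card := Nat.one_le_pow _ _ (Fact.out : p.Prime).pos
    push_cast [Nat.cast_sub h1]
    ring
  calc ((p : ℝ) ^ G.card - 1) * ρ ^ (D.gPrivSet G).card
      = ∑ t ∈ (tSet p G).erase 0, ρ ^ (D.gPrivSet G).card := by rw [Finset.sum_const, nsmul_eq_mul, hcard]
    _ ≤ ∑ t ∈ (tSet p G).erase 0, ρ ^ D.privWt G t :=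
        Finset.sum_le_sum fun t _ => pow_le_pow_of_le_one hρ0 hρ1 (by unfold privWt; exact card_filter_le _ _)
/-- A light group has rate `≤ 1/L`: `L·|G| ≤ |gPrivSet G|` (take any `t ≠ 0` on `G`). -/
theorem card_le_of_light (D : JLinData p n) {G : Finset (Fin (n + 1))} {L : ℕ} (hG : G ∈ D.lightGroups L) :
    L * G.card ≤ (D.gPrivSet G).card := by
  classical
  rw [mem_lightGroups] at hG
  obtain ⟨g₀, hg₀⟩ := hG.1
  set t : Fin (n + 1) → ZMod p := fun g => if g = g₀ then 1 else 0 with ht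
  have htmem : t ∈ tSet p G := mem_tSet.2 fun g hg => by
    rw [ht]; simp only
    rw [if_neg]; rintro rfl; exact hg hg₀
  have ht0 : t ≠ 0 := by
    intro h
    have := congr_fun h g₀
    rw [ht] at this
    simp at this
  exact (hG.2.2 t htmem ht0).trans (by unfold privWt; exact card_filter_le _ _)
/-- **Dense-read data are group-cores** (for `L·R > n`): a light group would own a private bit, all of whose `≥ R` readers
must belong to the group, forcing `L·R ≤ L·|G| ≤ |P_G| ≤ n`. -/
theorem groupCore_of_denseRead (D : JLinData p n) {R L : ℕ} (hR : D.sparseBits R = ∅) (hLR : n < L * R) :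
    D.lightGroups L = ∅ := by
  classical
  refine lightGroups_eq_empty_of_forall D fun G hGm => ?_
  have hG := (mem_lightGroups D).1 hGm
  have hL0 : 0 < L := Nat.pos_of_ne_zero fun h => by rw [h, zero_mul] at hLR; exact Nat.not_lt_zero _ hLR
  -- a nonzero assignment on `G` and a private bit where its twist vector is nonzero
  obtain ⟨g₀, hg₀⟩ := hG.1
  set t : Fin (n + 1) → ZMod p := fun g => if g = g₀ then 1 else 0 with ht
  have htmem : t ∈ tSet p G := mem_tSet.2 fun g hg => by
    rw [ht]; simp only
    rw [if_neg]; rintro rfl; exact hg hg₀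
  have ht0 : t ≠ 0 := by
    intro h
    have := congr_fun h g₀
    rw [ht] at this
    simp at this
  have hwt := hG.2.2 t htmem ht0
  have hpos : 0 < D.privWt G t := lt_of_lt_of_le (Nat.mul_pos hL0 (card_pos.2 hG.1)) hwt
  unfold privWt at hpos
  obtain ⟨i, hi⟩ := card_pos.1 hpos
  rw [mem_filter] at hi
  have hiP := hi.1
  unfold gPrivSet at hiP
  rw [mem_filter] at hiP
  -- some cut of `G` reads `i`
  have hread : ∃ g, D.a g i ≠ 0 := by
    by_contra hnone
    push Not at hnone
    apply hi.2
    unfold twistVec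
    exact Finset.sum_eq_zero fun g _ => by rw [hnone g, mul_zero]
  -- all readers of `i` are in `G`
  have hsub : (univ.filter fun g : Fin (n + 1) => D.a g i ≠ 0) ⊆ G := by
    intro g hg
    rw [mem_filter] at hg
    by_contra hgG
    exact hg.2 (hiP.2.2 g hgG)
  have hRi : R ≤ (univ.filter fun g : Fin (n + 1) => D.a g i ≠ 0).card := by
    by_contra hlt
    push Not at hlt
    have hmem : i ∈ D.sparseBits R := (mem_sparseBits D).2 ⟨hiP.2.1, hread, hlt⟩
    rw [hR] at hmem
    exact notMem_empty i hmem
  have h1 : R ≤ G.card := hRi.trans (card_le_card hsub)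
  have h2 : L * G.card ≤ n := (card_le_of_light D hGm).trans (by
    calc (D.gPrivSet G).card ≤ (univ : Finset (Fin n)).card := card_le_card (subset_univ _)
      _ = n := by simp)
  have : L * R ≤ n := (Nat.mul_le_mul_left L h1).trans h2
  omega
/-- A group-core is in particular an `L`-core in g9's sense (a cut owning `≥ L` private bits is a light singleton). -/
theorem core_of_groupCore (D : JLinData p n) {L : ℕ} (h : D.lightGroups L = ∅) :
    ∀ g, (D.suppForm g).Nonempty → D.priv g < L := by
  classical
  intro g hg
  by_contra hL
  push Not at hL
  apply not_mem_of_lightGroups_eq_empty D h {g}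
  rw [mem_lightGroups]
  refine ⟨singleton_nonempty g, singleton_subset_iff.2 ((mem_activeSet D g).2 hg), fun t ht ht0 => ?_⟩
  rw [card_singleton, mul_one]
  -- `t` is `t g • e_g` with `t g ≠ 0`
  have htg : t g ≠ 0 := by
    intro h0
    apply ht0
    funext g'
    by_cases hgg : g' = g
    · rw [hgg, h0]; rfl
    · exact mem_tSet.1 ht g' (by rwa [mem_singleton])
  refine hL.trans ?_
  unfold priv privWt
  refine card_le_card fun i hi => ?_
  unfold privSet at hi
  rw [mem_filter] at hi
  obtain ⟨hsupp, hJ, hothers⟩ := hi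
  unfold suppForm at hsupp
  rw [mem_filter] at hsupp
  rw [mem_filter]
  refine ⟨?_, ?_⟩
  · unfold gPrivSet
    rw [mem_filter]
    refine ⟨mem_univ _, fun g' => ?_, fun g' hg' => ?_⟩
    · by_cases hgg : g' = g
      · rw [hgg]; exact hJ
      · intro hi'
        exact hothers g' hgg (by unfold readSet; exact mem_union.2 (Or.inl hi'))
    · rw [mem_singleton] at hg'
      by_contra ha
      exact hothers g' hg' (by unfold readSet suppForm; exact mem_union.2 (Or.inr (mem_filter.2 ⟨mem_univ _, ha⟩)))
  · unfold twistVec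
    rw [sum_singleton]
    exact mul_ne_zero htg hsupp.2
/-- Lightness survives the freezing of ANOTHER light group (for the part outside it): privacy grows, twist vectors are kept. -/
theorem sdiff_mem_lightGroups_freezeAll (D : JLinData p n) {G H : Finset (Fin (n + 1))} {L : ℕ}
    (hH : H ∈ D.lightGroups L) (κ : Fin (n + 1) → ZMod p) (hne : (H \ G).Nonempty) :
    H \ G ∈ (D.freezeAll G κ).lightGroups L := by
  rw [mem_lightGroups] at hH ⊢
  refine ⟨hne, ?_, fun t ht ht0 => ?_⟩
  · intro g hg
    rw [activeSet_freezeAll, mem_sdiff]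
    exact ⟨hH.2.1 (mem_sdiff.1 hg).1, (mem_sdiff.1 hg).2⟩
  · have htH : t ∈ tSet p H := tSet_mono sdiff_subset ht
    have hwt := hH.2.2 t htH ht0
    have hcard : L * (H \ G).card ≤ L * H.card := Nat.mul_le_mul_left L (card_le_card sdiff_subset)
    refine hcard.trans (hwt.trans ?_)
    unfold privWt
    refine card_le_card fun i hi => ?_
    rw [mem_filter] at hi ⊢
    refine ⟨gPrivSet_subset_freezeAll D G H κ hi.1, ?_⟩
    rw [twistVec_freezeAll_of_disjoint D (fun g hg => (mem_sdiff.1 hg).2),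
      ← twistVec_eq_of_subset D sdiff_subset t (fun g hg => mem_tSet.1 ht g hg)]
    exact hi.2
/-- A light cover survives the freezing of one of its light groups. -/
theorem lightCover_freezeAll (D : JLinData p n) {G : Finset (Fin (n + 1))} {L : ℕ}
    (hcov : ∀ g ∈ D.activeSet, ∃ H ∈ D.lightGroups L, g ∈ H) (κ : Fin (n + 1) → ZMod p) :
    ∀ g ∈ (D.freezeAll G κ).activeSet, ∃ H ∈ (D.freezeAll G κ).lightGroups L, g ∈ H := by
  intro g hg
  rw [activeSet_freezeAll, mem_sdiff] at hg
  obtain ⟨H, hH, hgH⟩ := hcov g hg.1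
  exact ⟨H \ G, sdiff_mem_lightGroups_freezeAll D hH κ ⟨g, mem_sdiff.2 ⟨hgH, hg.2⟩⟩, mem_sdiff.2 ⟨hgH, hg.2⟩⟩

/-- Light groups are ANTITONE in the lightness parameter. -/
theorem lightGroups_mono (D : JLinData p n) {G : Finset (Fin (n + 1))} {L L' : ℕ}
    (h : G ∈ D.lightGroups L) (hL : L' ≤ L) : G ∈ D.lightGroups L' := by
  rw [mem_lightGroups] at h ⊢
  exact ⟨h.1, h.2.1, fun t ht ht0 => (Nat.mul_le_mul_right _ hL).trans (h.2.2 t ht ht0)⟩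
/-- Light covers are antitone in the lightness parameter. -/
theorem lightCover_mono (D : JLinData p n) {L L' : ℕ} (h : ∀ g ∈ D.activeSet, ∃ G ∈ D.lightGroups L, g ∈ G) (hL : L' ≤ L) :
    ∀ g ∈ D.activeSet, ∃ G ∈ D.lightGroups L', g ∈ G := fun g hg => by
  obtain ⟨G, hG, hgG⟩ := h g hg
  exact ⟨G, lightGroups_mono D hG hL, hgG⟩
/-- Group-cores are MONOTONE in the lightness parameter. -/
theorem groupCore_mono (D : JLinData p n) {L L' : ℕ} (h : D.lightGroups L = ∅) (hL : L ≤ L') : D.lightGroups L' = ∅ :=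
  lightGroups_eq_empty_of_forall D fun G hG => not_mem_of_lightGroups_eq_empty D h G (lightGroups_mono D hG hL)

end Fin

end JLinData

end Summit.QuantumAdvantage.AdviceFreeQNC0.JLinPeel

end
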